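import Summits.HubbardSuperconductivity.HubbardLadder.Bounds.SpinCorrelationEtaLineEuclid
import HarnessLib
import HarnessLib.Audit

/-!
# Hubbard ladder — Bounds: sharp Koma–Tasaki decay of the one-particle Green's function,
# `|⟨c†_{0σ} c_{zσ}⟩| ≲ |z|^{-T/(4π|t|)}`, machine-checked (bounds.tex Thm 10⁗)

HONEST FRAMING (cell pub-hubbard): ladder R1–R4 with certified numbers; no claim on H/H₀. These
are bounds for a MODEL CLASS — the grand-canonical Hubbard model `hubbardTorusWith 2 L t U μ` on
the square torus `(ℤ/Lℤ)²` (every `L ≥ 1`, all real `t, U, μ`, every `β > 0`); no materials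
claim. Companion text: `pub-hubbard/paper/bounds.tex` §Theorem 10 (Thm 10⁗); table
`pub-hubbard/pub-hubbard-bounds/BOUNDS.md` (row T8⁶).

## Content

Koma–Tasaki's method (PRL 68 (1992) 3248) "applies to other correlation functions": an
observable of gauge charge `c` under the charge gauge of eq. (5) gains `e^{-c(φ_x - φ_y)}`
against the spin-independent cost `exp[β|t| Σ_u Σ_v [u∼v](cosh(φ_u - φ_v) - 1)]` (eq. (11) as
printed; Literature `norm_thermalCorr_creation_annihilation_le_sharp`, `c = 1`). With the
explicit Euclidean truncated logarithmic dipole (`le_rpow_euclid_of_apriori` of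
`SpinCorrelationEtaLineEuclid.lean`) this gives, for every `q ≥ 0` with
`f := 2q - 4πβ|t|q² ≥ 0`, uniformly in `L` (`norm_green_le_rpow_euclid`):
`|⟨c†_{xσ} c_{yσ}⟩_{β,L}| ≤ K(q) 5^f (dist(x,y)+1)^{-f}`, `K(q) = exp[2β|t|(2πq² + 76q² + 544q⁴e^{2q²})]`,
optimum `q* = 1/(4πβ|t|)`, `f* = 1/(4πβ|t|) = T/(4π|t|)` — the McBryan–Spencer scaling
`η ∝ (charge)²` (a quarter of the pair/spin exponent `T/(π|t|)`). Proved here: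

* `norm_green_le_rpow_euclid` — the explicit torus bound;
* `GreenDecaySharp` / `greenDecaySharp_holds` — thermodynamic-limit form: for all `t, U, μ`,
  `β > 0`, `σ`, `ε > 0` and `|z| ≥ R(ε)`,
  `limsup_{L→∞} |⟨c†_{0σ} c_{zσ}⟩_{β,L+1}| ≤ |z|^{-(1-ε)/(4πβ|t|)}`.

Reading: an explicit, `U`- and filling-independent algebraic decay rate of the equal-time
one-particle density matrix of the 2D Hubbard model at every `T > 0`; NOT claimed: optimality
within the method, exponential decay (expected at `T > 0` but not obtainable by this method),
anything about momentum-space quantities.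

References (keys of `lean/references.bib`): KomaTasakiPRL1992 (eqs. (5)–(12)); McBryanSpencer1977.
-/

noncomputable section

namespace Summit.HubbardSuperconductivity.HubbardLadder.Bounds

open Matrix Finset NormedSpace
open Literature.MathematicalPhysics.QuantumLattice Literature.Probability.LatticeModels
open scoped Matrix.Norms.L2Operator ComplexOrder

/-- **The sharp explicit one-particle bound (Koma–Tasaki's printed hopping norm, charge gauge,
gauge charge `1`; machine-checked).** For the nearest-neighbour Hubbard model on `(ℤ/Lℤ)²`, all
real `t, U, μ`, every `β ≥ 0`, every `q ≥ 0` with `f := 2q - 4πβ|t|q² ≥ 0`, all sites `x, y`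
and every spin `σ`: `|⟨c†_{xσ} c_{yσ}⟩_{β,L}| ≤ K(q) 5^f (dist(x,y)+1)^{-f}`,
`K(q) = exp[2β|t|(2πq² + 76q² + 544q⁴e^{2q²})]`, uniformly in `L`; at `q = 1/(4πβ|t|)` the
exponent is `1/(4πβ|t|) = T/(4π|t|)` (bounds.tex Thm 10⁗). -/
theorem norm_green_le_rpow_euclid (L : ℕ) [NeZero L] (t U μ β q : ℝ) (hβ : 0 ≤ β)
    (hq : 0 ≤ q) (hf : 0 ≤ 2 * q - 4 * Real.pi * (β * |t|) * q ^ 2) (x y : TorusSite 2 L)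
    (σ : Fin 2) :
    ‖(hubbardTorusWith 2 L t U μ).thermalCorr β
        (creation (orb (FermionTorus.ofTorusSite x) σ))
        (annihilation (orb (FermionTorus.ofTorusSite y) σ))‖ ≤
      Real.exp (2 * (β * |t|) *
          (2 * Real.pi * q ^ 2 + 76 * q ^ 2 + 544 * q ^ 4 * Real.exp (2 * q ^ 2))) *
        ((5 : ℝ) ^ (2 * q - 4 * Real.pi * (β * |t|) * q ^ 2) *
          ((torusDist x y : ℝ) + 1) ^ (-(2 * q - 4 * Real.pi * (β * |t|) * q ^ 2))) :=
  le_rpow_euclid_of_apriori L (β * |t|) 1 q _ _ (mul_nonneg hβ (abs_nonneg t)) hq x y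
    (fun φ => (norm_thermalCorr_creation_annihilation_le_sharp t U μ β hβ φ x y σ).trans_eq
      (by rw [one_mul, mul_assoc]))
    (by ring) hf

/-- For every `M ≥ 1`, `z` and `σ`, `|⟨c†_{0σ} c_{zσ}⟩_{β,M}| ≤ 1` (the a priori bound with
`ψ = 0`). -/
theorem norm_green_torusSiteOfInt_le_one (M : ℕ) [NeZero M] (t U μ β : ℝ) (hβ : 0 ≤ β)
    (z : Fin 2 → ℤ) (σ : Fin 2) :
    ‖(hubbardTorusWith 2 M t U μ).thermalCorr β
        (creation (orb (FermionTorus.ofTorusSite (torusSiteOfInt M 0)) σ))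
        (annihilation (orb (FermionTorus.ofTorusSite (torusSiteOfInt M z)) σ))‖ ≤ 1 := by
  have h0 := norm_thermalCorr_creation_annihilation_le_sharp t U μ β hβ (fun _ => (0 : ℝ))
    (torusSiteOfInt M 0) (torusSiteOfInt M z) σ
  simp only [sub_self, mul_zero, neg_zero, Real.cosh_zero, ite_self, sum_const_zero,
    Real.exp_zero, mul_one] at h0
  exact h0

/-- **Thm 10⁗ (sharp Koma–Tasaki decay of the one-particle Green's function; PROVED below).**
For all real `t, U, μ`, every `β > 0`, spin `σ` and `ε > 0` there is `R` such that for every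
`z ∈ ℤ²` with `|z| ≥ R`,
`limsup_{L→∞} |⟨c†_{0σ} c_{zσ}⟩_{β,L+1}| ≤ |z|^{-(1-ε)/(4πβ|t|)}` — algebraic decay of the
equal-time one-particle density matrix of the 2D Hubbard model with the explicit exponent
`T/(4π|t|)`, at every `U` and filling. At `t = 0` the exponent is the junk value `0` and the
bound `1` holds. kind: support (PROVED). Why it might fail: it cannot (proved). Sources:
KomaTasakiPRL1992 eqs. (5)–(12) ("applies to other correlation functions"); McBryanSpencer1977;
this cell bounds.tex Thm 10⁗. -/
@[conjecture] def GreenDecaySharp : Prop :=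
  ∀ (t U μ β : ℝ), 0 < β → ∀ (σ : Fin 2) (ε : ℝ), 0 < ε → ∃ R : ℝ, ∀ z : Fin 2 → ℤ,
    R ≤ intNorm z →
    Filter.limsup (fun L : ℕ => ‖(hubbardTorusWith 2 (L + 1) t U μ).thermalCorr β
        (creation (orb (FermionTorus.ofTorusSite (torusSiteOfInt (L + 1) 0)) σ))
        (annihilation (orb (FermionTorus.ofTorusSite (torusSiteOfInt (L + 1) z)) σ))‖)
      Filter.atTop ≤ intNorm z ^ (-((1 - ε) / (4 * Real.pi * β * |t|)))

/-- **`GreenDecaySharp` holds**: `norm_green_le_rpow_euclid` at `q* = 1/(4πβ|t|)`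
(`f* = 1/(4πβ|t|)`) fed into `exists_limsup_le_rpow` with slack `e = ε f*`; at `t = 0`
termwise `≤ 1`. -/
theorem greenDecaySharp_holds : GreenDecaySharp := by
  intro t U μ β hβ σ ε hε
  by_cases ht : β * |t| = 0
  · -- `t = 0`: the exponent is the junk value `0`, the bound `1` holds termwise
    refine ⟨0, fun z _ => ?_⟩
    have hexp : -((1 - ε) / (4 * Real.pi * β * |t|)) = 0 := by
      rw [mul_assoc, ht, mul_zero, div_zero, neg_zero]
    rw [hexp, Real.rpow_zero]
    exact Filter.limsup_le_of_le
      (Filter.isCoboundedUnder_le_of_le _ (fun L => norm_nonneg _))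
      (Filter.Eventually.of_forall fun L =>
        norm_green_torusSiteOfInt_le_one (L + 1) t U μ β hβ.le z σ)
  · -- `β|t| > 0`: the Euclidean dipole at `q* = 1/(4πβ|t|)`
    have hβt : 0 ≤ β * |t| := mul_nonneg hβ.le (abs_nonneg t)
    have hb0 : 0 < β * |t| := lt_of_le_of_ne hβt (Ne.symm ht)
    have hπ := Real.pi_pos
    have hπb : Real.pi * (β * |t|) ≠ 0 := by positivity
    set q : ℝ := 1 / (4 * Real.pi * (β * |t|)) with hq
    have hq0 : 0 ≤ q := by positivity
    set fs : ℝ := 2 * q - 4 * Real.pi * (β * |t|) * q ^ 2 with hfs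
    have hfval : fs = 1 / (4 * Real.pi * (β * |t|)) := by
      rw [hfs, hq]
      field_simp
      ring
    have hfpos : 0 < fs := by rw [hfval]; positivity
    have hεf : 0 < ε * fs := by positivity
    obtain ⟨R, hR⟩ := exists_limsup_le_rpow
      (fun L z => ‖(hubbardTorusWith 2 (L + 1) t U μ).thermalCorr β
        (creation (orb (FermionTorus.ofTorusSite (torusSiteOfInt (L + 1) 0)) σ))
        (annihilation (orb (FermionTorus.ofTorusSite (torusSiteOfInt (L + 1) z)) σ))‖)
      (Real.exp (2 * (β * |t|) *
        (2 * Real.pi * q ^ 2 + 76 * q ^ 2 + 544 * q ^ 4 * Real.exp (2 * q ^ 2))))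
      fs (ε * fs) (Real.exp_pos _) hfpos hεf (fun L z => norm_nonneg _)
      (fun L z => norm_green_le_rpow_euclid (L + 1) t U μ β q hβ.le hq0 hfpos.le _ _ σ)
    refine ⟨R, fun z hz => ?_⟩
    have hexp : -((1 - ε) / (4 * Real.pi * β * |t|)) = -fs + ε * fs := by
      rw [hfval, show 4 * Real.pi * β * |t| = 4 * Real.pi * (β * |t|) by ring]
      field_simp
      ring
    rw [hexp]
    exact hR z hz

end Summit.HubbardSuperconductivity.HubbardLadder.Bounds

end
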